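import Summits.BirchSwinnertonDyer.BirchSwinnertonDyer.Theses.KolyvaginRankRigidityAtTwo

/-!
# Route `KolyvaginRankRigidityAtTwo`, R5-37: glue of the print-split of V2♭∞ (modus ponens)

Item `CorankLowerBoundAtTwoRichOfPrintSplit` (stmt-BirchSwinnertonDyer-28230, glue of the split of crux V2♭∞
`KolyvaginCorankLowerBoundAtTwoRich`, stmt-27984, into the print fact `Prop37FrobeniusCongruenceAtTwo` (stmt-23091)
and the kernel half `CorankLowerBoundAtTwoRichOfProp37` (stmt-28229)):
`Prop37FrobeniusCongruenceAtTwo → CorankLowerBoundAtTwoRichOfProp37 → KolyvaginCorankLowerBoundAtTwoRich` — modus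
ponens. THEOREM-ONLY file (no definition, no named fact, no `sorry`); logic only. Nothing about any curve is
asserted; V2♭∞ is not closed by this (the print fact stays open); BSD is not proved by this. Pen seat `bsd-idea-1` g7.
-/

set_option autoImplicit false
set_option linter.dupNamespace false

namespace Summit.BirchSwinnertonDyer.BirchSwinnertonDyer.Theorems.KolyvaginRigidity

open Summit.BirchSwinnertonDyer.BirchSwinnertonDyer.Theses.KolyvaginRankRigidityAtTwo

/-- **Glue of the print-split of V2♭∞** (modus ponens). [folklore] -/
theorem corankLowerBoundAtTwoRichOfPrintSplit_proof : CorankLowerBoundAtTwoRichOfPrintSplit := fun h g => g h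

end Summit.BirchSwinnertonDyer.BirchSwinnertonDyer.Theorems.KolyvaginRigidity
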